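import Summits.CriticalPhenomena.PercolationContinuityZ3.Theorems.PercNearOneGluingNoHeavyLowerTailQ7PsiZFree
import HarnessLib

/-!
# `NoHeavyLowerTail` (stmt-CriticalPhenomena-4575) — the `x`-half of the (GΨ₃) certificate from the
# observer covariance comparison (P1** ⟹ P1*)

Support file (`--supports stmt-CriticalPhenomena-4575`), coupling seat `prim-cplus-coupling` (gen 7).  No
definitions, no named facts, no sorries.

Context (seat memo A5-COUPLING-gen7.md §0.2–0.3, §2; companion of `…Q7PsiDomReduction.lean`, whose
`opart_of_halves` consumes the conclusion of this file as its hypothesis (P1*)).  Notation (all events of one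
bond percolation `μ = prodBernoulli w`): `E1 = {x↮y} ∩ {x↮z}`, `E2 = {y↮x} ∩ {y↮z}`, `F = {x↔y} ∩ {x↮z}`,
`D = {x↮z} = E1 ⊔ F`, `a = μ(x↔o ∩ E1)`, `b = μ(y↔o ∩ E2)`, `d = μ(x↔o ∩ F)`.  The census certificate uses the
split `t* = φE1/(φE1+φE2)` (`φE1 = a/μ(E1)`, `φE2 = b/μ(E2)`), i.e. `t*·(a μ(E2) + b μ(E1)) = a μ(E2)`, and the
multiplier `λ* = (a + t* d)/μ(D)`.

* `Q7Psi.p1star_of_cov` — if the **observer covariance comparison (P1**)**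
  `μ(E2)·[μ(D) ∫_{x↔o ∩ D} F(C x) − μ(x↔o ∩ D) ∫_D F(C x)] ≥ b·[μ(D) ∫_F F(C x) − μ(F) ∫_D F(C x)]`
  (i.e. `Cov(F(C x), 𝟙{o ∈ C x} | x↮z) ≥ φE2 · Cov(F(C x), 𝟙{y ∈ C x} | x↮z)`) holds for a monotone `F`, then the
  `x`-half (P1*) `λ* ∫_D F(C x) ≤ ∫_{x↔o ∩ E1} F(C x) + t* ∫_{x↔o ∩ F} F(C x)` holds.  Proof: the identity
  `μ(E1)μ(E2)·[(P1*)·μ(D)] = t*·μ(E1)·(P1**) + μ(D)(1−t*)μ(E2)·(BHK)` where (BHK) is van den Berg–Häggström–Kahn's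
  Thm 1.3 given `x ↮ {y,z}`: `μ(E1) ∫_{x↔o ∩ E1} F(C x) ≥ a ∫_{E1} F(C x)`.
The `z`-free case of (P1**) is the tree theorem `Q7Psi.obs_cov_ge`; (P1**) itself is the seat's conjecture
(0 violations in every exact census, constant `φE2` sharp).
[cite: KozmaNitzan2024, §5.1 (pp. 31–32), Question 7 (p. 36)] [cite: VandenbergHaggstromKahn2005, Thm 1.3 (p. 6)]
-/

namespace Summit.CriticalPhenomena.PercolationContinuityZ3.Theorems

open MeasureTheory Set Literature.Probability.LatticeModels Literature.Probability.Percolation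
open scoped Classical
open KNPreFKG

noncomputable section

namespace Q7Psi

variable {V : Type*} [Fintype V]

/-- **BHK Thm 1.3 given `x ↮ {y, z}`, for a real cluster property and the observer**: with
`E1 = {x↮y} ∩ {x↮z}`, `(∫_{E1} F(C x)) · μ(E1 ∩ {x↔o}) ≤ μ(E1) · ∫_{E1 ∩ {x↔o}} F(C x)`.
[cite: VandenbergHaggstromKahn2005, Thm. 1.3 (p. 6)] -/
theorem obs_pos_E1 (w : Sym2 V → unitInterval) (o x y z : V) (hxy : x ≠ y) (hxz : x ≠ z) (F : Set V → ℝ)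
    (hF : ∀ S T : Set V, S ⊆ T → F S ≤ F T) :
    (∫ ω in {ω : BondConfig V | ¬ (openGraph ω).Reachable x y} ∩ {ω | ¬ (openGraph ω).Reachable x z},
          F (openCluster ω x) ∂(prodBernoulli w)) *
        (prodBernoulli w).real (({ω : BondConfig V | ¬ (openGraph ω).Reachable x y} ∩
          {ω | ¬ (openGraph ω).Reachable x z}) ∩ openConn x o) ≤
      (prodBernoulli w).real ({ω : BondConfig V | ¬ (openGraph ω).Reachable x y} ∩
          {ω | ¬ (openGraph ω).Reachable x z}) *
        ∫ ω in ({ω : BondConfig V | ¬ (openGraph ω).Reachable x y} ∩ {ω | ¬ (openGraph ω).Reachable x z}) ∩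
            openConn x o, F (openCluster ω x) ∂(prodBernoulli w) := by
  classical
  have hD : {ω : BondConfig V | ∀ t ∈ ({y, z} : Set V), ¬ (openGraph ω).Reachable x t} =
      {ω : BondConfig V | ¬ (openGraph ω).Reachable x y} ∩ {ω | ¬ (openGraph ω).Reachable x z} := by
    ext ω
    simp only [mem_insert_iff, mem_singleton_iff, forall_eq_or_imp, forall_eq, mem_setOf_eq, mem_inter_iff]
  have hx : x ∉ ({y, z} : Set V) := by
    simp only [mem_insert_iff, mem_singleton_iff, not_or]
    exact ⟨hxy, hxz⟩
  have key := BHK2006_clusterConditionalPositiveAssociation_holds V w x ({y, z} : Set V)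
    (fun C => F {a | a = x ∨ ∃ e ∈ C, a ∈ e}) (connIndicatorFn x o) (monotone_clusterFun x F hF)
    (monotone_connIndicatorFn x o) hx
  simp only [hD, clusterFun_openEdgeCluster, connIndicatorFn_openEdgeCluster] at key
  rw [setIntegral_mul_indicator_one, setIntegral_indicator_one_eq] at key
  exact key

/-- **The `x`-half (P1*) of the (GΨ₃) certificate from the observer covariance comparison (P1**).**
Notation as in the file header (`E1, E2, F, D = {x↮z}`, `a, b, d`).  If `t (a μ(E2) + b μ(E1)) = a μ(E2)` with
`0 ≤ t ≤ 1` (the census split `t*`), `λ μ(D) = a + t d` (the census multiplier `λ*`), `μ(E1), μ(E2) > 0`, and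
(P1**) `μ(E2)·[μ(D) ∫_{x↔o ∩ D} F(C x) − μ(x↔o ∩ D) ∫_D F(C x)] ≥ b·[μ(D) ∫_F F(C x) − μ(F) ∫_D F(C x)]`
holds for the monotone cluster property `F`, then `λ ∫_D F(C x) ≤ ∫_{x↔o ∩ E1} F(C x) + t ∫_{x↔o ∩ F} F(C x)`.
[cite: KozmaNitzan2024, §5.1 (pp. 31–32)] [cite: VandenbergHaggstromKahn2005, Thm 1.3 (p. 6)] -/
theorem p1star_of_cov (w : Sym2 V → unitInterval) (o x y z : V) (hxy : x ≠ y) (hxz : x ≠ z)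
    (F : Set V → ℝ) (hF : ∀ S T : Set V, S ⊆ T → F S ≤ F T) (t lam : ℝ) (ht0 : 0 ≤ t) (ht1 : t ≤ 1)
    (hE1 : 0 < (prodBernoulli w).real ({ω : BondConfig V | ¬ (openGraph ω).Reachable x y} ∩
      {ω | ¬ (openGraph ω).Reachable x z}))
    (hE2 : 0 < (prodBernoulli w).real ({ω : BondConfig V | ¬ (openGraph ω).Reachable y x} ∩
      {ω | ¬ (openGraph ω).Reachable y z}))
    (ht : t * ((prodBernoulli w).real (openConn x o ∩ {ω | ¬ (openGraph ω).Reachable x y} ∩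
            {ω | ¬ (openGraph ω).Reachable x z}) *
          (prodBernoulli w).real ({ω : BondConfig V | ¬ (openGraph ω).Reachable y x} ∩
            {ω | ¬ (openGraph ω).Reachable y z}) +
        (prodBernoulli w).real (openConn y o ∩ {ω | ¬ (openGraph ω).Reachable y x} ∩
            {ω | ¬ (openGraph ω).Reachable y z}) *
          (prodBernoulli w).real ({ω : BondConfig V | ¬ (openGraph ω).Reachable x y} ∩
            {ω | ¬ (openGraph ω).Reachable x z})) =
      (prodBernoulli w).real (openConn x o ∩ {ω | ¬ (openGraph ω).Reachable x y} ∩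
          {ω | ¬ (openGraph ω).Reachable x z}) *
        (prodBernoulli w).real ({ω : BondConfig V | ¬ (openGraph ω).Reachable y x} ∩
          {ω | ¬ (openGraph ω).Reachable y z}))
    (hlam : lam * (prodBernoulli w).real {ω : BondConfig V | ¬ (openGraph ω).Reachable x z} =
      (prodBernoulli w).real (openConn x o ∩ {ω | ¬ (openGraph ω).Reachable x y} ∩
          {ω | ¬ (openGraph ω).Reachable x z}) +
        t * (prodBernoulli w).real (openConn x o ∩ openConn x y ∩ {ω | ¬ (openGraph ω).Reachable x z}))
    (hcov : (prodBernoulli w).real (openConn y o ∩ {ω | ¬ (openGraph ω).Reachable y x} ∩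
            {ω | ¬ (openGraph ω).Reachable y z}) *
        ((prodBernoulli w).real {ω : BondConfig V | ¬ (openGraph ω).Reachable x z} *
            (∫ ω in openConn x y ∩ {ω | ¬ (openGraph ω).Reachable x z}, F (openCluster ω x) ∂(prodBernoulli w)) -
          (prodBernoulli w).real (openConn x y ∩ {ω | ¬ (openGraph ω).Reachable x z}) *
            ∫ ω in {ω : BondConfig V | ¬ (openGraph ω).Reachable x z}, F (openCluster ω x) ∂(prodBernoulli w)) ≤
      (prodBernoulli w).real ({ω : BondConfig V | ¬ (openGraph ω).Reachable y x} ∩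
          {ω | ¬ (openGraph ω).Reachable y z}) *
        ((prodBernoulli w).real {ω : BondConfig V | ¬ (openGraph ω).Reachable x z} *
            (∫ ω in openConn x o ∩ {ω | ¬ (openGraph ω).Reachable x z}, F (openCluster ω x) ∂(prodBernoulli w)) -
          (prodBernoulli w).real (openConn x o ∩ {ω | ¬ (openGraph ω).Reachable x z}) *
            ∫ ω in {ω : BondConfig V | ¬ (openGraph ω).Reachable x z}, F (openCluster ω x) ∂(prodBernoulli w))) :
    lam * ∫ ω in {ω : BondConfig V | ¬ (openGraph ω).Reachable x z}, F (openCluster ω x) ∂(prodBernoulli w) ≤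
      (∫ ω in openConn x o ∩ {ω | ¬ (openGraph ω).Reachable x y} ∩ {ω | ¬ (openGraph ω).Reachable x z},
          F (openCluster ω x) ∂(prodBernoulli w)) +
        t * ∫ ω in openConn x o ∩ openConn x y ∩ {ω | ¬ (openGraph ω).Reachable x z},
          F (openCluster ω x) ∂(prodBernoulli w) := by
  classical
  set μ := prodBernoulli w with hμ
  set f : BondConfig V → ℝ := fun ω => F (openCluster ω x) with hf
  set Dxz : Set (BondConfig V) := {ω | ¬ (openGraph ω).Reachable x z} with hDxz
  set Nxy : Set (BondConfig V) := {ω | ¬ (openGraph ω).Reachable x y} with hNxy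
  set E2 : Set (BondConfig V) := {ω : BondConfig V | ¬ (openGraph ω).Reachable y x} ∩
    {ω | ¬ (openGraph ω).Reachable y z} with hE2def
  set E1 : Set (BondConfig V) := Nxy ∩ Dxz with hE1def
  set Fev : Set (BondConfig V) := openConn x y ∩ Dxz with hFev
  set S1 : Set (BondConfig V) := openConn x o ∩ Nxy ∩ Dxz with hS1
  set S3 : Set (BondConfig V) := openConn x o ∩ openConn x y ∩ Dxz with hS3
  set S2 : Set (BondConfig V) := openConn y o ∩ {ω : BondConfig V | ¬ (openGraph ω).Reachable y x} ∩
    {ω | ¬ (openGraph ω).Reachable y z} with hS2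
  set OD : Set (BondConfig V) := openConn x o ∩ Dxz with hOD
  have hmeas : ∀ S : Set (BondConfig V), MeasurableSet S := fun _ => MeasurableSet.of_discrete
  have hint : ∀ (g : BondConfig V → ℝ) (S : Set (BondConfig V)), IntegrableOn g S μ :=
    fun g S => (Integrable.of_finite).integrableOn
  -- rename the hypotheses
  change 0 < μ.real E1 at hE1
  change 0 < μ.real E2 at hE2
  change t * (μ.real S1 * μ.real E2 + μ.real S2 * μ.real E1) = μ.real S1 * μ.real E2 at ht
  change lam * μ.real Dxz = μ.real S1 + t * μ.real S3 at hlam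
  change μ.real S2 * (μ.real Dxz * (∫ ω in Fev, f ω ∂μ) - μ.real Fev * ∫ ω in Dxz, f ω ∂μ) ≤
    μ.real E2 * (μ.real Dxz * (∫ ω in OD, f ω ∂μ) - μ.real OD * ∫ ω in Dxz, f ω ∂μ) at hcov
  show lam * ∫ ω in Dxz, f ω ∂μ ≤ (∫ ω in S1, f ω ∂μ) + t * ∫ ω in S3, f ω ∂μ
  -- (BHK) `(∫_{E1} f) μ(S1) ≤ μ(E1) ∫_{S1} f`
  have hB := obs_pos_E1 w o x y z hxy hxz F hF
  have hS1E : E1 ∩ openConn x o = S1 := by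
    ext ω; simp only [hE1def, hS1, mem_inter_iff]; tauto
  rw [hS1E] at hB
  change (∫ ω in E1, f ω ∂μ) * μ.real S1 ≤ μ.real E1 * ∫ ω in S1, f ω ∂μ at hB
  -- event identities: `Dxz = E1 ⊔ Fev`, `OD = S1 ⊔ S3`
  have hDsplit : Dxz = E1 ∪ Fev := by
    ext ω
    simp only [hE1def, hFev, hNxy, mem_union, mem_inter_iff, mem_setOf_eq, openConn]
    constructor
    · intro h
      by_cases hr : (openGraph ω).Reachable x y
      · exact Or.inr ⟨hr, h⟩
      · exact Or.inl ⟨hr, h⟩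
    · rintro (⟨_, h⟩ | ⟨_, h⟩) <;> exact h
  have hDdisj : Disjoint E1 Fev := by
    rw [Set.disjoint_left]
    rintro ω ⟨hn, _⟩ ⟨hr, _⟩
    exact hn hr
  have hODsplit : OD = S1 ∪ S3 := by
    ext ω
    simp only [hOD, hS1, hS3, hNxy, mem_union, mem_inter_iff, mem_setOf_eq, openConn]
    constructor
    · rintro ⟨hxo, hD⟩
      by_cases hr : (openGraph ω).Reachable x y
      · exact Or.inr ⟨⟨hxo, hr⟩, hD⟩
      · exact Or.inl ⟨⟨hxo, hr⟩, hD⟩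
    · rintro (⟨⟨hxo, _⟩, hD⟩ | ⟨⟨hxo, _⟩, hD⟩) <;> exact ⟨hxo, hD⟩
  have hODdisj : Disjoint S1 S3 := by
    rw [Set.disjoint_left]
    rintro ω ⟨⟨_, hn⟩, _⟩ ⟨⟨_, hr⟩, _⟩
    exact hn hr
  have hmD : μ.real Dxz = μ.real E1 + μ.real Fev := by
    rw [hDsplit, measureReal_union hDdisj (hmeas _)]
  have hmOD : μ.real OD = μ.real S1 + μ.real S3 := by
    rw [hODsplit, measureReal_union hODdisj (hmeas _)]
  have hID : ∫ ω in Dxz, f ω ∂μ = ∫ ω in E1, f ω ∂μ + ∫ ω in Fev, f ω ∂μ := by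
    rw [hDsplit, setIntegral_union hDdisj (hmeas _) (hint _ _) (hint _ _)]
  have hIOD : ∫ ω in OD, f ω ∂μ = ∫ ω in S1, f ω ∂μ + ∫ ω in S3, f ω ∂μ := by
    rw [hODsplit, setIntegral_union hODdisj (hmeas _) (hint _ _) (hint _ _)]
  -- abbreviations
  set a := μ.real S1 with ha
  set b := μ.real S2 with hb
  set d := μ.real S3 with hd
  set e1 := μ.real E1 with he1
  set e2 := μ.real E2 with he2
  set mF := μ.real Fev with hmF
  set Ax := μ.real Dxz with hAx
  set IS1 := ∫ ω in S1, f ω ∂μ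
  set IS3 := ∫ ω in S3, f ω ∂μ
  set IE1 := ∫ ω in E1, f ω ∂μ
  set IF := ∫ ω in Fev, f ω ∂μ
  rw [hmOD, hIOD, hID] at hcov
  rw [hID]
  -- the certificate identity: e1 e2 · T = t e1 · (P1**) + Ax (1 - t) e2 · (BHK), then divide by e1 e2 > 0
  have hAxnn : 0 ≤ Ax := measureReal_nonneg
  have hH1 : 0 ≤ e2 * (Ax * (IS1 + IS3) - (a + d) * (IE1 + IF)) - b * (Ax * IF - mF * (IE1 + IF)) := by
    linarith
  have hH2 : 0 ≤ e1 * IS1 - a * IE1 := by linarith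
  have hT : 0 ≤ e1 * e2 * (Ax * IS1 + t * Ax * IS3 - (a + t * d) * (IE1 + IF)) := by
    have hid : e1 * e2 * (Ax * IS1 + t * Ax * IS3 - (a + t * d) * (IE1 + IF)) =
        t * e1 * (e2 * (Ax * (IS1 + IS3) - (a + d) * (IE1 + IF)) - b * (Ax * IF - mF * (IE1 + IF))) +
          Ax * (1 - t) * e2 * (e1 * IS1 - a * IE1) := by
      have hAx' : Ax = e1 + mF := hmD
      rw [hAx']
      linear_combination (e1 * IF - mF * IE1) * ht
    rw [hid]
    have h1 : 0 ≤ t * e1 * (e2 * (Ax * (IS1 + IS3) - (a + d) * (IE1 + IF)) - b * (Ax * IF - mF * (IE1 + IF))) :=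
      mul_nonneg (mul_nonneg ht0 hE1.le) hH1
    have h2 : 0 ≤ Ax * (1 - t) * e2 * (e1 * IS1 - a * IE1) :=
      mul_nonneg (mul_nonneg (mul_nonneg hAxnn (by linarith)) hE2.le) hH2
    linarith
  have hT' : 0 ≤ Ax * IS1 + t * Ax * IS3 - (a + t * d) * (IE1 + IF) := by
    have hpos : 0 < e1 * e2 := mul_pos hE1 hE2
    have h0 : e1 * e2 * 0 ≤ e1 * e2 * (Ax * IS1 + t * Ax * IS3 - (a + t * d) * (IE1 + IF)) := by
      rw [mul_zero]; exact hT
    exact le_of_mul_le_mul_left h0 hpos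
  -- conclude: `lam * (IE1 + IF) ≤ IS1 + t IS3`, using `lam * Ax = a + t d`
  by_cases hAx0 : Ax = 0
  · -- `μ(D) = 0`: all the integrals over subsets of `D` vanish
    have hμD : μ Dxz = 0 := (measureReal_eq_zero_iff (measure_ne_top _ _)).1 hAx0
    have hsub : ∀ S : Set (BondConfig V), S ⊆ Dxz → ∫ ω in S, f ω ∂μ = 0 :=
      fun S hS => setIntegral_measure_zero _ (measure_mono_null hS hμD)
    have z1 : IE1 = 0 := hsub E1 inter_subset_right
    have z2 : IF = 0 := hsub Fev inter_subset_right
    have z3 : IS1 = 0 := hsub S1 inter_subset_right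
    have z4 : IS3 = 0 := hsub S3 inter_subset_right
    rw [z1, z2, z3, z4]
    simp
  · have hAxpos : 0 < Ax := lt_of_le_of_ne hAxnn (Ne.symm hAx0)
    have hprod : Ax * (lam * (IE1 + IF)) = (a + t * d) * (IE1 + IF) := by
      rw [← hlam]; ring
    have key : Ax * (lam * (IE1 + IF)) ≤ Ax * (IS1 + t * IS3) := by
      rw [hprod]; linarith
    exact le_of_mul_le_mul_left key hAxpos

end Q7Psi

end

end Summit.CriticalPhenomena.PercolationContinuityZ3.Theorems
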